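import Literature.MathematicalPhysics.QuantumLattice.FermiRG.FST2Regularity
import Mathlib.Analysis.LocallyConvex.Separation
import Mathlib.Analysis.Calculus.LagrangeMultipliers
import Mathlib.Topology.Algebra.IsUniformGroup.Basic
import HarnessLib

/-!
# Feldman–Salmhofer–Trubowitz II: proof of Lemma `\Lem\findCP` (the critical points on the Fermi surface)

Topic `Literature/MathematicalPhysics/QuantumLattice/FermiRG`. A PROOF COMPANION of
`FST2Regularity.lean` (gate-hubbard-kl wave file F4b, DEFINITION FROZEN): it DISCHARGES the named fact
`LemmaFindCP` (licence F-031) of that file,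

  `theorem LemmaFindCP_holds : LemmaFindCP`,

without touching the frozen file. Source:

* [II] J. Feldman, M. Salmhofer, E. Trubowitz, *Perturbation theory around non-nested Fermi surfaces II.
  Regularity of the moving Fermi surface: RPA contributions*, Comm. Pure Appl. Math. **51** (1998)
  1133–1246, arXiv:cond-mat/9701073 (`FeldmanSalmhoferTrubowitz1998`); locators `p.N Lm` = chunk
  `pNNNN.txt`, line `m`, of the `lit read arxiv:cond-mat/9701073` render of the arXiv TeX.

## The printed proof and how it is followed [II §3.4, p.16 L15–58]

"Denote `Q = L_b(p₁, p₂, p)`. Then `∇e(Q)·∂_θ p(0,θ₁) = 0 ⟹ p₁ ∈ {Q, a(Q)}` and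
`∇e(Q)·∂_θ p(0,θ₂) = 0 ⟹ p₂ ∈ {Q, a(Q)}` (therego). Let `b = 1`. Then `Q = p + p₁ - p₂`; given `p₁`
the table `(θ₂, θ', p) ∈ {(θ₁,θ₁,p₁), (θ₁,a(θ₁),a(p₁)), (a(θ₁),θ₁,a(p₁)), (a(θ₁),a(θ₁),2a(p₁)-p₁)}`;
the first three rows produce `c_{1,1}, c_{1,3}, c_{1,2}`; the last row drops out because Lemma
`\Lem\byAfive` gives `Q = p = p₁`, a contradiction. `b = 2` by exchanging `θ₁, θ₂`; `b = 3` has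
`p = -Q + p₁ + p₂`" — and (p.16 L77–80) "the collinearity argument could not have been applied without
(A5) because if `2a(p₁) - p₁` is on a copy of `S` obtained by translation by some `γ ∈ Γ#`, the three
vectors could differ"; cf. p.8 L3–5: "by (A5), both sides are vectors in `F̊` … we may consider `S` as
a subset of `ℝ^d` instead of `𝓑`".

The Lean proof has exactly this architecture, for the coordinate-free typing of `LemmaFindCP`
(points of `S ∩ F`, the critical-point condition "the tangent hyperplane of `S` at `pᵢ` is
orthogonal to `∇e(Q)`"):

1. `exists_smul_of_orthogonal_imp`: the critical-point condition says `∇e(Q) ∥ ∇e(pᵢ)`.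
2. The step `∇e(Q) ∥ ∇e(pᵢ) ⟹ pᵢ ∈ {Q, a(Q)}` is the injectivity of the Gauss map of the strictly
   convex Fermi surface up to the antipode ([II] p.7 L60–66: "strict convexity implies that
   `n(a(p)) = -n(p)` has, for any `p ∈ S`, a unique solution"). In the typed setting (`S ∩ F = ∂C` for
   a compact strictly convex body `C`, `HypA3Global`) this is where the work is:
   * `HypA5.eventually_mem_fermiSurfaceRep`: near a point of `S ∩ F` the periodic surface `S` IS
     `S ∩ F` ((A5) forbids two points of `S ∩ F` differing by a dual-lattice vector; `Γ#` is discrete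
     and `C` compact) — the typed form of "we may consider `S` as a subset of `ℝ^d`";
   * `normal_or_neg_normal`: at `x ∈ ∂C`, `∇e(x)` or `-∇e(x)` is an outward normal of `C` (a
     supporting functional exists by Hahn–Banach, and it is a multiple of `e'(x)` by the Lagrange
     multiplier rule for its maximum on `S` at `x`);
   * `eq_of_forall_inner_le`: a non-zero linear functional has ONE maximiser on a strictly convex body;
   * hence `eq_or_eq_antipode_of_gradient_eq_smul` (Gauss-map injectivity up to `a`), and the
     consequences `IsAntipodalMapOn.apply_ne` (`a(p) ≠ p`, p.7 L67) and `IsAntipodalMapOn.apply_apply`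
     (`a(a(p)) = p`); and, by the same supporting-hyperplane argument, **Lemma 2.1′ (ii)**
     (`\Lem\byAfive` (ii), the longest chord, p.7 L152–157): `eq_antipode_of_sub_eq_antipode_sub`, PROVED
     (part (i) is `eq_of_two_smul_eq_add_of_hypA3Global` of `FST2Regularity.lean`).
3. The table, for `b = 1, 2, 3`: four rows each; rows ending in a lattice translate of a point of
   `S ∩ F` are settled by `HypA5.eq_of_eq_add` / `HypA5.combo_eq_combo` ((A5): both sides lie in `F`,
   representatives are unique), and the "last rows" by the tree's Lemma `\Lem\byAfive` (i)
   (`eq_of_two_smul_eq_add_of_hypA3Global`, proved in `FST2Regularity.lean`).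

The local curvature half `HypA3` of (A3) and the hypothesis `d ≥ 2` of the fact are not needed beyond
what `HypA3Global` already provides (`d ≥ 2` is used only to know that `E` is finite-dimensional).
No new definitions, no new facts; imports Mathlib + the frozen `FST2Regularity.lean` only.
-/

noncomputable section

open Set Filter Metric
open scoped Topology InnerProductSpace

namespace Literature.MathematicalPhysics.QuantumLattice.FermiRG

section FindCPProof

variable {E : Type*} [NormedAddCommGroup E] [InnerProductSpace ℝ E]

/-! ### Step 1: the critical-point condition makes `∇e(Q)` parallel to `∇e(pᵢ)` -/

/-- If `u ≠ 0` and every vector orthogonal to `u` is orthogonal to `w`, then `w` is a multiple of `u`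
(the hyperplane `u^⊥` determines the line `ℝu`). [folklore] -/
private theorem exists_smul_of_orthogonal_imp {u w : E} (hu : u ≠ 0)
    (h : ∀ t : E, ⟪u, t⟫_ℝ = 0 → ⟪w, t⟫_ℝ = 0) : ∃ c : ℝ, w = c • u := by
  have huu : ⟪u, u⟫_ℝ ≠ 0 := inner_self_ne_zero.mpr hu
  set c : ℝ := ⟪u, w⟫_ℝ / ⟪u, u⟫_ℝ with hc
  have hut : ⟪u, w - c • u⟫_ℝ = 0 := by
    rw [inner_sub_right, real_inner_smul_right, hc, div_mul_cancel₀ _ huu, sub_self]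
  have hwt : ⟪w, w - c • u⟫_ℝ = 0 := h _ hut
  have htt : ⟪w - c • u, w - c • u⟫_ℝ = 0 := by
    rw [inner_sub_left, real_inner_smul_left, hwt, hut, mul_zero, sub_zero]
  exact ⟨c, sub_eq_zero.mp (inner_self_eq_zero.mp htt)⟩

/-! ### (A5): combinations `±p ± q` of points of `S ∩ F` are determined in `ℝ^d`, not only on `𝓑` -/

/-- Two points of the fundamental domain `F` that differ by a vector of `Γ#` are equal (`F` is a set
of unique representatives of `𝓑 = E/Γ#`).
[cite: FeldmanSalmhoferTrubowitz1998, §2.1 (arXiv p.6 L108–118)] -/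
theorem Crystal.eq_of_sub_mem_dualLattice (cr : Crystal E) {z w : E} (hz : z ∈ cr.fundamentalDomain)
    (hw : w ∈ cr.fundamentalDomain) (hzw : z - w ∈ cr.dualLattice) : z = w := by
  obtain ⟨g, -, huniq⟩ := cr.existsUnique_rep w
  have h0 : (0 : cr.dualLattice) = g := huniq 0 (by simpa using hw)
  have h1 : (⟨z - w, hzw⟩ : cr.dualLattice) = g := huniq ⟨z - w, hzw⟩ (by simpa using hz)
  have h2 : ((⟨z - w, hzw⟩ : cr.dualLattice) : E) = ((0 : cr.dualLattice) : E) := by rw [h1, ← h0]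
  exact sub_eq_zero.mp (by simpa using h2)

/-- Under (A5), `u • p + v • q ∈ F` for `p, q ∈ S ∩ F` and signs `u, v` ((A5) puts it in `F̊`).
[cite: FeldmanSalmhoferTrubowitz1998, Assumption A5 (arXiv p.7 L98–99)] -/
theorem HypA5.combo_mem {cr : Crystal E} {e : E → ℝ} (h5 : HypA5 cr e) {p q : E}
    (hp : p ∈ cr.fermiSurfaceRep e) (hq : q ∈ cr.fermiSurfaceRep e) {u v : ℝ}
    (hu : u = 1 ∨ u = -1) (hv : v = 1 ∨ v = -1) : u • p + v • q ∈ cr.fundamentalDomain :=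
  interior_subset (h5 p hp q hq u v hu hv)

/-- [II] p.8 L3–5: "By (A5), both sides of the equations are vectors in `F̊` … therefore, to determine
their solutions, we may consider `S` as a subset of `ℝ^d` instead of `𝓑`": two signed combinations
`u • p + v • q`, `u' • p' + v' • q'` of points of `S ∩ F` that agree modulo `Γ#` agree in `E`.
[cite: FeldmanSalmhoferTrubowitz1998, Lemma byAfive proof (arXiv p.8 L3–5)] -/
theorem HypA5.combo_eq_combo {cr : Crystal E} {e : E → ℝ} (h5 : HypA5 cr e) {p q p' q' : E}
    (hp : p ∈ cr.fermiSurfaceRep e) (hq : q ∈ cr.fermiSurfaceRep e)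
    (hp' : p' ∈ cr.fermiSurfaceRep e) (hq' : q' ∈ cr.fermiSurfaceRep e) {u v u' v' : ℝ}
    (hu : u = 1 ∨ u = -1) (hv : v = 1 ∨ v = -1) (hu' : u' = 1 ∨ u' = -1) (hv' : v' = 1 ∨ v' = -1)
    {γ : E} (hγ : γ ∈ cr.dualLattice) (h : u • p + v • q = u' • p' + v' • q' + γ) :
    u • p + v • q = u' • p' + v' • q' :=
  cr.eq_of_sub_mem_dualLattice (h5.combo_mem hp hq hu hv) (h5.combo_mem hp' hq' hu' hv')
    (by rw [h, add_sub_cancel_left]; exact hγ)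

/-- Under (A5), two points of `S ∩ F` that differ by a vector of `Γ#` are equal; in particular no two
distinct points of `S ∩ F` are `Γ#`-translates of each other (p.16 L77–80: the translation copies of
`S` are what (A5) keeps apart). [cite: FeldmanSalmhoferTrubowitz1998, §3.4 (arXiv p.16 L77–80)] -/
theorem HypA5.eq_of_eq_add {cr : Crystal E} {e : E → ℝ} (h5 : HypA5 cr e) {x y : E}
    (hx : x ∈ cr.fermiSurfaceRep e) (hy : y ∈ cr.fermiSurfaceRep e) {γ : E}
    (hγ : γ ∈ cr.dualLattice) (h : x = y + γ) : x = y := by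
  have key := h5.combo_eq_combo hx hy hy hy (Or.inl rfl) (Or.inr rfl) (Or.inl rfl) (Or.inr rfl)
    (u := 1) (v := -1) (u' := 1) (v' := -1) hγ (by rw [h]; module)
  calc x = (1 : ℝ) • x + (-1 : ℝ) • y + y := by module
    _ = (1 : ℝ) • y + (-1 : ℝ) • y + y := by rw [key]
    _ = y := by module

/-! ### Step 2a: near a point of `S ∩ F`, the Fermi surface is `S ∩ F` -/

/-- Under (A5) (with `S ∩ F = ∂C`, `C` compact — the global half of (A3) — and `e` periodic): every
point `x ∈ S ∩ F` has a neighbourhood in which the (periodic) Fermi surface `S` coincides with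
`S ∩ F`. Indeed a point of `S` near `x` is `z - γ` with `z ∈ S ∩ F ⊆ C` and `γ ∈ Γ#` bounded, hence in a
finite set (`Γ#` is discrete); for `γ ≠ 0`, `x + γ ∉ S ∩ F` by `HypA5.eq_of_eq_add`, and `S ∩ F` is
closed. The typed form of "we may consider `S` as a subset of `ℝ^d` instead of `𝓑`" (p.8 L3–5).
[cite: FeldmanSalmhoferTrubowitz1998, Lemma byAfive proof (arXiv p.8 L3–5)] -/
theorem HypA5.eventually_mem_fermiSurfaceRep [FiniteDimensional ℝ E] {cr : Crystal E}
    {e : E → ℝ} (hper : IsLatticePeriodic cr.dualLattice e) (hG : HypA3Global cr e)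
    (h5 : HypA5 cr e) {x : E} (hx : x ∈ cr.fermiSurfaceRep e) :
    ∀ᶠ y in 𝓝 x, y ∈ fermiSurface e → y ∈ cr.fermiSurfaceRep e := by
  obtain ⟨C, hCc, -, -, hS⟩ := hG
  haveI := cr.discrete
  have hsub : cr.fermiSurfaceRep e ⊆ C := by
    rw [hS]; exact frontier_subset_closure.trans hCc.isClosed.closure_subset
  have hScl : IsClosed (cr.fermiSurfaceRep e) := by rw [hS]; exact isClosed_frontier
  obtain ⟨R, hR⟩ := isBounded_iff_forall_norm_le.mp hCc.isBounded
  -- the lattice vectors of norm `≤ R + ‖x‖ + 1` form a finite set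
  have hclosed : IsClosed (X := E) cr.dualLattice :=
    @AddSubgroup.isClosed_of_discrete _ _ _ _ _ cr.dualLattice.toAddSubgroup
      (inferInstanceAs (DiscreteTopology cr.dualLattice))
  set G : Set E := closedBall (0 : E) (R + (‖x‖ + 1)) ∩ (cr.dualLattice : Set E) with hGdef
  have hfin : G.Finite := by
    rw [hGdef]
    change (_ ∩ (cr.dualLattice.toAddSubgroup : Set E)).Finite
    have : DiscreteTopology cr.dualLattice.toAddSubgroup :=
      inferInstanceAs (DiscreteTopology cr.dualLattice)
    exact Metric.finite_isBounded_inter_isClosed DiscreteTopology.isDiscrete isBounded_closedBall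
      hclosed
  -- for each non-zero such vector `g`, `x + g ∉ S ∩ F`, an open condition in `x`
  set U : Set E := ⋂ g ∈ G, {y : E | g ≠ 0 → y + g ∉ cr.fermiSurfaceRep e}
  have hUo : IsOpen U := by
    refine hfin.isOpen_biInter fun g _ => ?_
    by_cases hg : g = 0
    · have : {y : E | g ≠ 0 → y + g ∉ cr.fermiSurfaceRep e} = univ := by
        ext y; simp [hg]
      rw [this]; exact isOpen_univ
    · have : {y : E | g ≠ 0 → y + g ∉ cr.fermiSurfaceRep e} =
          (fun y : E => y + g) ⁻¹' (cr.fermiSurfaceRep e)ᶜ := by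
        ext y; simp [hg]
      rw [this]
      exact hScl.isOpen_compl.preimage (continuous_id.add continuous_const)
  have hxU : x ∈ U := by
    refine mem_iInter₂.mpr fun g hg => ?_
    rw [mem_setOf_eq]
    intro hg0 hxg
    apply hg0
    have := h5.eq_of_eq_add hxg hx hg.2 rfl
    simpa using this
  filter_upwards [hUo.mem_nhds hxU, ball_mem_nhds x one_pos] with y hyU hyB hyS
  obtain ⟨g, hgF, -⟩ := cr.existsUnique_rep y
  have hyg : y + (g : E) ∈ cr.fermiSurfaceRep e :=
    ⟨by rw [mem_fermiSurface, hper _ g.2]; exact hyS, hgF⟩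
  have hgn : ‖(g : E)‖ ≤ R + (‖x‖ + 1) := by
    have h1 : ‖(g : E)‖ ≤ ‖y + g‖ + ‖y‖ := by
      simpa [add_sub_cancel_left] using norm_sub_le (y + (g : E)) y
    have h2 : ‖y‖ ≤ ‖x‖ + ‖y - x‖ := norm_le_insert' y x
    have h3 : ‖y - x‖ < 1 := by rwa [mem_ball, dist_eq_norm] at hyB
    linarith [hR _ (hsub hyg)]
  have hgG : (g : E) ∈ G := ⟨mem_closedBall_zero_iff.mpr hgn, g.2⟩
  by_cases hg0 : (g : E) = 0
  · rw [hg0, add_zero] at hyg; exact hyg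
  · have := mem_iInter₂.mp hyU (g : E) hgG
    rw [mem_setOf_eq] at this
    exact absurd hyg (this hg0)

/-! ### Step 2b: the outward normal of `C` at a point of `S ∩ F = ∂C` is `±∇e` -/

/-- A non-zero vector `w` is "maximised" at most at one point of a strictly convex set `C`: if
`⟪w, c⟫ ≤ ⟪w, x⟫` and `⟪w, c⟫ ≤ ⟪w, y⟫` for all `c ∈ C`, `x, y ∈ C`, then `x = y` (otherwise the
midpoint is interior and `w` increases along `w` from it). [folklore] -/
private theorem eq_of_forall_inner_le {C : Set E} (hCs : StrictConvex ℝ C) {x y w : E} (hw : w ≠ 0)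
    (hxC : x ∈ C) (hyC : y ∈ C) (hx : ∀ c ∈ C, ⟪w, c⟫_ℝ ≤ ⟪w, x⟫_ℝ)
    (hy : ∀ c ∈ C, ⟪w, c⟫_ℝ ≤ ⟪w, y⟫_ℝ) : x = y := by
  by_contra hxy
  have hmid : (1 / 2 : ℝ) • x + (1 / 2 : ℝ) • y ∈ interior C :=
    hCs hxC hyC hxy (by norm_num) (by norm_num) (by norm_num)
  obtain ⟨r, hr, hball⟩ := Metric.isOpen_iff.mp isOpen_interior _ hmid
  have hwn : 0 < ‖w‖ := norm_pos_iff.mpr hw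
  set z : E := ((1 / 2 : ℝ) • x + (1 / 2 : ℝ) • y) + (r / (2 * ‖w‖)) • w with hz
  have hzC : z ∈ C := by
    refine interior_subset (hball ?_)
    rw [mem_ball, dist_eq_norm, hz, add_sub_cancel_left, norm_smul,
      Real.norm_of_nonneg (by positivity)]
    have : r / (2 * ‖w‖) * ‖w‖ = r / 2 := by field_simp
    rw [this]; linarith
  have h1 := hx y hyC
  have h2 := hy x hxC
  have h3 := hx z hzC
  have hz' : ⟪w, z⟫_ℝ = 1 / 2 * ⟪w, x⟫_ℝ + 1 / 2 * ⟪w, y⟫_ℝ + r / (2 * ‖w‖) * (‖w‖ * ‖w‖) := by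
    rw [hz, inner_add_right, inner_add_right, real_inner_smul_right, real_inner_smul_right,
      real_inner_smul_right, real_inner_self_eq_norm_mul_norm]
  have hpos : 0 < r / (2 * ‖w‖) * (‖w‖ * ‖w‖) := by positivity
  linarith

/-- Rescaling an outward normal: if `v = s • u` with `s ≠ 0` and `v` or `-v` is maximised on `C` at
`z`, then `u` or `-u` is. [folklore] -/
private theorem forall_inner_le_or_of_eq_smul {C : Set E} {z u v : E} {s : ℝ}
    (hv : (∀ c ∈ C, ⟪v, c⟫_ℝ ≤ ⟪v, z⟫_ℝ) ∨ (∀ c ∈ C, ⟪-v, c⟫_ℝ ≤ ⟪-v, z⟫_ℝ))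
    (hs : s ≠ 0) (h : v = s • u) :
    (∀ c ∈ C, ⟪u, c⟫_ℝ ≤ ⟪u, z⟫_ℝ) ∨ (∀ c ∈ C, ⟪-u, c⟫_ℝ ≤ ⟪-u, z⟫_ℝ) := by
  have key : ∀ {w : E} {t : ℝ}, 0 < t → (∀ c ∈ C, ⟪t • w, c⟫_ℝ ≤ ⟪t • w, z⟫_ℝ) →
      ∀ c ∈ C, ⟪w, c⟫_ℝ ≤ ⟪w, z⟫_ℝ := by
    intro w t ht H c hc
    have := H c hc
    rw [real_inner_smul_left, real_inner_smul_left] at this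
    exact le_of_mul_le_mul_left this ht
  rcases lt_or_gt_of_ne hs with hneg | hpos
  · rcases hv with hv | hv
    · right
      refine key (t := -s) (by linarith) ?_
      intro c hc
      rw [smul_neg, neg_smul, neg_neg, ← h]
      exact hv c hc
    · left
      refine key (t := -s) (by linarith) ?_
      intro c hc
      rw [neg_smul, ← h]
      exact hv c hc
  · rcases hv with hv | hv
    · left
      exact key hpos (fun c hc => by rw [← h]; exact hv c hc)
    · right
      refine key (t := s) hpos ?_
      intro c hc
      rw [smul_neg, ← h]
      exact hv c hc

variable [CompleteSpace E]

/-- If the unit normals at `y` and `x` are proportional, `n(y) = s n(x)`, and `∇e(y) ≠ 0`, then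
`∇e(y) = (|∇e(y)| s / |∇e(x)|) ∇e(x)`. [folklore] -/
private theorem gradient_eq_smul_of_unitNormal {e : E → ℝ} {x y : E} {s : ℝ}
    (hy : gradient e y ≠ 0) (h : unitNormal e y = s • unitNormal e x) :
    gradient e y = (‖gradient e y‖ * s * ‖gradient e x‖⁻¹) • gradient e x := by
  unfold unitNormal at h
  have hn : ‖gradient e y‖ ≠ 0 := norm_ne_zero_iff.mpr hy
  calc gradient e y = ‖gradient e y‖ • (‖gradient e y‖⁻¹ • gradient e y) := by
        rw [smul_smul, mul_inv_cancel₀ hn, one_smul]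
    _ = ‖gradient e y‖ • (s • (‖gradient e x‖⁻¹ • gradient e x)) := by rw [h]
    _ = (‖gradient e y‖ * s * ‖gradient e x‖⁻¹) • gradient e x := by
        rw [smul_smul, smul_smul, mul_assoc]

/-- If `n(z) = -n(z)` for the unit normal `n = ∇e/|∇e|`, then `∇e(z) = 0`. [folklore] -/
private theorem gradient_eq_zero_of_unitNormal_eq_neg {e : E → ℝ} {z : E}
    (h : unitNormal e z = -unitNormal e z) : gradient e z = 0 := by
  have h2 : (2 : ℝ) • unitNormal e z = 0 := by
    rw [two_smul]; nth_rewrite 1 [h]; exact neg_add_cancel _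
  have hn : unitNormal e z = 0 := (smul_eq_zero.mp h2).resolve_left two_ne_zero
  unfold unitNormal at hn
  rcases smul_eq_zero.mp hn with h' | h'
  · exact norm_eq_zero.mp (inv_eq_zero.mp h')
  · exact h'

/-- At a point `x` of `S ∩ F = ∂C` (`C` a compact strictly convex body with non-empty interior, `e`
periodic and `C²` with `∇e ≠ 0` on `S`, (A5)), the gradient `∇e(x)` or its negative is an OUTWARD
NORMAL of `C`: `⟪±∇e(x), c - x⟫ ≤ 0` for all `c ∈ C`. A supporting functional `f ≠ 0` at the boundary
point `x` exists (Hahn–Banach); `f` restricted to the hypersurface `S` (which near `x` lies in `C`, by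
`HypA5.eventually_mem_fermiSurfaceRep`) has a local maximum at `x`, so by the Lagrange multiplier
rule `f` is a multiple of `e'(x)`. This is the typed content of "`n = ∇e/|∇e|` is the unit normal to
`S`" for the convex body bounded by `S` ([II] p.7 L63).
[cite: FeldmanSalmhoferTrubowitz1998, §2.1 (arXiv p.7 L59–66)] -/
theorem normal_or_neg_normal [FiniteDimensional ℝ E] {cr : Crystal E} {e : E → ℝ}
    (hA2 : HypA2 cr 2 0 e) (h5 : HypA5 cr e) {C : Set E} (hCc : IsCompact C)
    (hCs : StrictConvex ℝ C) (hCi : (interior C).Nonempty) (hS : cr.fermiSurfaceRep e = frontier C)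
    {x : E} (hx : x ∈ cr.fermiSurfaceRep e) :
    (∀ c ∈ C, ⟪gradient e x, c⟫_ℝ ≤ ⟪gradient e x, x⟫_ℝ) ∨
      (∀ c ∈ C, ⟪-gradient e x, c⟫_ℝ ≤ ⟪-gradient e x, x⟫_ℝ) := by
  have hxF : x ∈ frontier C := hS ▸ hx
  have hxi : x ∉ interior C := by
    rw [frontier, Set.mem_sdiff] at hxF; exact hxF.2
  have hsub : frontier C ⊆ C := frontier_subset_closure.trans hCc.isClosed.closure_subset
  obtain ⟨f, hf0, hfle⟩ := geometric_hahn_banach_of_nonempty_interior_point hCs.convex hxi hCi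
  -- `f` restricted to the level set `S = {e = 0}` has a local maximum at `x`
  have hev := h5.eventually_mem_fermiSurfaceRep hA2.periodic ⟨C, hCc, hCs, hCi, hS⟩ hx
  have hx0 : e x = 0 := hx.1
  have hextr : IsLocalExtrOn f {y | e y = e x} x := by
    refine IsMaxFilter.isExtr ?_
    show ∀ᶠ y in 𝓝[{y | e y = e x}] x, f y ≤ f x
    filter_upwards [self_mem_nhdsWithin, mem_nhdsWithin_of_mem_nhds hev] with y hy hy'
    have hyx : e y = e x := hy
    have hyS : y ∈ fermiSurface e := by rw [mem_fermiSurface, hyx, hx0]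
    exact hfle y (hsub (hS ▸ hy' hyS))
  have hcd : ContDiff ℝ 2 e := hA2.memContDiffHolder.1
  have hsd : HasStrictFDerivAt e (fderiv ℝ e x) x :=
    hcd.contDiffAt.hasStrictFDerivAt (by norm_num)
  obtain ⟨α, β, hαβ, hlin⟩ := hextr.exists_multipliers_of_hasStrictFDerivAt_1d hsd
    f.hasStrictFDerivAt
  have hgx : gradient e x ≠ 0 := hA2.gradient_ne_zero x hx.1
  have hβ : β ≠ 0 := by
    rintro rfl
    have hα : α ≠ 0 := fun h => hαβ (by rw [h]; rfl)
    rw [zero_smul, add_zero] at hlin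
    have h0 : fderiv ℝ e x = 0 := (smul_eq_zero.mp hlin).resolve_left hα
    apply hgx
    unfold gradient; rw [h0, map_zero]
  -- `f = μ e'(x)` with `μ = -α/β ≠ 0`
  have hfeq : ∀ v : E, f v = -(α / β) * fderiv ℝ e x v := by
    intro v
    have h1 := congrArg (fun L : StrongDual ℝ E => L v) hlin
    simp only [add_apply, smul_apply, smul_eq_mul, zero_apply] at h1
    have key : β * f v = -(α * fderiv ℝ e x v) := by linear_combination h1
    calc f v = β⁻¹ * (β * f v) := by rw [← mul_assoc, inv_mul_cancel₀ hβ, one_mul]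
      _ = -(α / β) * fderiv ℝ e x v := by rw [key]; ring
  have hf : ∀ v : E, f v = -(α / β) * ⟪gradient e x, v⟫_ℝ := by
    intro v
    rw [hfeq]
    unfold gradient; rw [InnerProductSpace.toDual_symm_apply]
  have hμ : -(α / β) ≠ 0 := by
    intro h0; apply hf0
    ext v
    rw [hfeq v, h0, zero_mul, zero_apply]
  rcases lt_or_gt_of_ne hμ with hneg | hpos
  · right
    intro c hc
    have := hfle c hc
    rw [hf c, hf x] at this
    rw [inner_neg_left, inner_neg_left]
    exact neg_le_neg ((mul_le_mul_left_of_neg hneg).mp this)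
  · left
    intro c hc
    have := hfle c hc
    rw [hf c, hf x] at this
    exact le_of_mul_le_mul_left this hpos

/-! ### Step 2c: injectivity of the Gauss map up to the antipode [II p.7 L60–66] -/

/-- [II] p.7 L60–66: "Strict convexity implies that the equation `n(a(p)) = -n(p)` has, for any
`p ∈ S`, a unique solution `a(p) ∈ S`" — in the form used in the proof of Lemma `\Lem\findCP`
((therego), p.16 L18–23): if `x, y ∈ S ∩ F` have parallel gradients, `∇e(y) = c ∇e(x)`, then
`y = x` or `y = a(x)`, for any antipodal map `a` of `S ∩ F`. Hypotheses: `e ∈ C²` periodic with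
`∇e ≠ 0` on `S` ((A2)_{2,0}), the global half of (A3), (A5).
[cite: FeldmanSalmhoferTrubowitz1998, §2.1 (arXiv p.7 L60–66) and eq. (therego) (p.16 L18–23)] -/
theorem eq_or_eq_antipode_of_gradient_eq_smul [FiniteDimensional ℝ E] {cr : Crystal E}
    {e : E → ℝ} {a : E → E} (hA2 : HypA2 cr 2 0 e) (hG : HypA3Global cr e) (h5 : HypA5 cr e)
    (ha : IsAntipodalMapOn e (cr.fermiSurfaceRep e) a) {x y : E}
    (hx : x ∈ cr.fermiSurfaceRep e) (hy : y ∈ cr.fermiSurfaceRep e) {c : ℝ}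
    (hc : gradient e y = c • gradient e x) : y = x ∨ y = a x := by
  obtain ⟨C, hCc, hCs, hCi, hS⟩ := hG
  have hsub : frontier C ⊆ C := frontier_subset_closure.trans hCc.isClosed.closure_subset
  have memC : ∀ z ∈ cr.fermiSurfaceRep e, z ∈ C := fun z hz => hsub (hS ▸ hz)
  obtain ⟨hax, hanti⟩ := ha x hx
  have hgx : gradient e x ≠ 0 := hA2.gradient_ne_zero x hx.1
  have hgy : gradient e y ≠ 0 := hA2.gradient_ne_zero y hy.1
  have hga : gradient e (a x) ≠ 0 := hA2.gradient_ne_zero (a x) hax.1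
  have hngx : -gradient e x ≠ 0 := neg_ne_zero.mpr hgx
  have hc0 : c ≠ 0 := by
    rintro rfl; rw [zero_smul] at hc; exact hgy hc
  -- `∇e(a x)` is a (negative) multiple of `∇e(x)`
  have hκ := gradient_eq_smul_of_unitNormal hga (s := -1) (x := x)
    (by rw [hanti.2.2, neg_one_smul])
  have hκ0 : ‖gradient e (a x)‖ * (-1) * ‖gradient e x‖⁻¹ ≠ 0 :=
    mul_ne_zero (mul_ne_zero (norm_ne_zero_iff.mpr hga) (by norm_num))
      (inv_ne_zero (norm_ne_zero_iff.mpr hgx))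
  -- `a x ≠ x`
  have hne : a x ≠ x := by
    intro h
    have h2 := hanti.2.2
    rw [h] at h2
    exact hgx (gradient_eq_zero_of_unitNormal_eq_neg h2)
  have Nx := normal_or_neg_normal hA2 h5 hCc hCs hCi hS hx
  have Na := forall_inner_le_or_of_eq_smul (normal_or_neg_normal hA2 h5 hCc hCs hCi hS hax) hκ0 hκ
  have Ny := forall_inner_le_or_of_eq_smul (normal_or_neg_normal hA2 h5 hCc hCs hCi hS hy) hc0 hc
  rcases Nx with Nx | Nx <;> rcases Na with Na | Na <;> rcases Ny with Ny | Ny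
  · exact absurd (eq_of_forall_inner_le hCs hgx (memC _ hax) (memC _ hx) Na Nx) hne
  · exact absurd (eq_of_forall_inner_le hCs hgx (memC _ hax) (memC _ hx) Na Nx) hne
  · exact Or.inl (eq_of_forall_inner_le hCs hgx (memC _ hy) (memC _ hx) Ny Nx)
  · exact Or.inr (eq_of_forall_inner_le hCs hngx (memC _ hy) (memC _ hax) Ny Na)
  · exact Or.inr (eq_of_forall_inner_le hCs hgx (memC _ hy) (memC _ hax) Ny Na)
  · exact Or.inl (eq_of_forall_inner_le hCs hngx (memC _ hy) (memC _ hx) Ny Nx)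
  · exact absurd (eq_of_forall_inner_le hCs hngx (memC _ hax) (memC _ hx) Na Nx) hne
  · exact absurd (eq_of_forall_inner_le hCs hngx (memC _ hax) (memC _ hx) Na Nx) hne

/-- [II] p.7 L67: "Necessarily, `a(p) ≠ p`" — for any antipodal map `a` of `S ∩ F` and `p ∈ S ∩ F`
(`∇e(p) ≠ 0` by (A2)). [cite: FeldmanSalmhoferTrubowitz1998, §2.1 (arXiv p.7 L67)] -/
theorem IsAntipodalMapOn.apply_ne {cr : Crystal E} {e : E → ℝ} {a : E → E} {k : ℕ} {h : NNReal}
    (hA2 : HypA2 cr k h e) (ha : IsAntipodalMapOn e (cr.fermiSurfaceRep e) a) {x : E}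
    (hx : x ∈ cr.fermiSurfaceRep e) : a x ≠ x := by
  intro hax
  obtain ⟨-, hanti⟩ := ha x hx
  have h2 := hanti.2.2
  rw [hax] at h2
  exact hA2.gradient_ne_zero x hx.1 (gradient_eq_zero_of_unitNormal_eq_neg h2)

/-- The antipodal map is an involution of `S ∩ F`: `a(a(p)) = p` (uniqueness of the antipode, [II]
p.7 L60–66, applied to `n(a(a(p))) = -n(a(p)) = n(p)`). Hypotheses as in
`eq_or_eq_antipode_of_gradient_eq_smul`.
[cite: FeldmanSalmhoferTrubowitz1998, §2.1 (arXiv p.7 L60–66)] -/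
theorem IsAntipodalMapOn.apply_apply [FiniteDimensional ℝ E] {cr : Crystal E} {e : E → ℝ}
    {a : E → E} (hA2 : HypA2 cr 2 0 e) (hG : HypA3Global cr e) (h5 : HypA5 cr e)
    (ha : IsAntipodalMapOn e (cr.fermiSurfaceRep e) a) {x : E} (hx : x ∈ cr.fermiSurfaceRep e) :
    a (a x) = x := by
  obtain ⟨hax, hanti⟩ := ha x hx
  obtain ⟨haax, hanti2⟩ := ha (a x) hax
  have hgaa : gradient e (a (a x)) ≠ 0 := hA2.gradient_ne_zero _ haax.1
  have hn : unitNormal e (a (a x)) = (1 : ℝ) • unitNormal e x := by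
    rw [one_smul, hanti2.2.2, hanti.2.2, neg_neg]
  rcases eq_or_eq_antipode_of_gradient_eq_smul hA2 hG h5 ha hx haax
      (gradient_eq_smul_of_unitNormal hgaa hn) with h | h
  · exact h
  · exfalso
    have h2 := hanti2.2.2
    rw [h] at h2
    exact hA2.gradient_ne_zero _ hax.1 (gradient_eq_zero_of_unitNormal_eq_neg h2)

/-! ### Lemma 2.1′ (ii) of [II] (`\Lem\byAfive` (ii)): the longest chord [II p.7 L152–157, p.8 L13–35] -/

/-- FST2.L.byAfive (ii) · [II] **Lemma 2.1′ (ii)** (TeX `\Lem\byAfive` (ii)) · p.7 L152–157 (proof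
p.8 L13–35): "For a given `p₂ ∈ S`, the equation `p₁ - p = a(p₂) - p₂`, `p₁, p ∈ S`, has only the
solution `p₁ = a(p₂)`, `p = p₂`" — "the chord from `p₂` to its antipode `a(p₂)` is strictly longer than
any other chord of `S` in direction `r` … because `S` is strictly convex, it remains on one side of each
of the [two parallel] tangent planes and it intersects the tangent planes only at `p₂` and `a(p₂)`".
PROVED, with the tangent planes realised as the supporting hyperplanes `⟪±∇e(p₂), ·⟫ = const` of
`normal_or_neg_normal`: for the outward normal `n` of `C` at `p₂`, `-n` is outward at `a(p₂)`, so
`⟪n, p₁ - p⟫ ≥ ⟪n, a(p₂) - p₂⟫` with equality only at the two support points. Hypotheses as in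
`eq_or_eq_antipode_of_gradient_eq_smul` ((A2)_{2,0}, the global half of (A3), (A5), `a` an antipodal map
of `S ∩ F`; points of `S` read in `F`, as print does by (A5), p.8 L3–5).
[cite: FeldmanSalmhoferTrubowitz1998, Lemma byAfive (ii) §2.1 (arXiv p.7 L152–157, p.8 L13–35)] -/
theorem eq_antipode_of_sub_eq_antipode_sub [FiniteDimensional ℝ E] {cr : Crystal E} {e : E → ℝ}
    {a : E → E} (hA2 : HypA2 cr 2 0 e) (hG : HypA3Global cr e) (h5 : HypA5 cr e)
    (ha : IsAntipodalMapOn e (cr.fermiSurfaceRep e) a) {p₂ p₁ p : E}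
    (hp₂ : p₂ ∈ cr.fermiSurfaceRep e) (hp₁ : p₁ ∈ cr.fermiSurfaceRep e)
    (hp : p ∈ cr.fermiSurfaceRep e) (h : p₁ - p = a p₂ - p₂) : p₁ = a p₂ ∧ p = p₂ := by
  have hne : a p₂ ≠ p₂ := ha.apply_ne hA2 hp₂
  obtain ⟨C, hCc, hCs, hCi, hS⟩ := hG
  have hsub : frontier C ⊆ C := frontier_subset_closure.trans hCc.isClosed.closure_subset
  have memC : ∀ z ∈ cr.fermiSurfaceRep e, z ∈ C := fun z hz => hsub (hS ▸ hz)
  obtain ⟨hap, hanti⟩ := ha p₂ hp₂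
  have hg2 : gradient e p₂ ≠ 0 := hA2.gradient_ne_zero p₂ hp₂.1
  have hga : gradient e (a p₂) ≠ 0 := hA2.gradient_ne_zero (a p₂) hap.1
  have hng2 : -gradient e p₂ ≠ 0 := neg_ne_zero.mpr hg2
  have hκ := gradient_eq_smul_of_unitNormal hga (s := -1) (x := p₂)
    (by rw [hanti.2.2, neg_one_smul])
  have hκ0 : ‖gradient e (a p₂)‖ * (-1) * ‖gradient e p₂‖⁻¹ ≠ 0 :=
    mul_ne_zero (mul_ne_zero (norm_ne_zero_iff.mpr hga) (by norm_num))
      (inv_ne_zero (norm_ne_zero_iff.mpr hg2))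
  have N2 := normal_or_neg_normal hA2 h5 hCc hCs hCi hS hp₂
  have Na := forall_inner_le_or_of_eq_smul (normal_or_neg_normal hA2 h5 hCc hCs hCi hS hap) hκ0 hκ
  -- the argument for an outward normal `w` of `C` at `p₂` such that `-w` is outward at `a p₂`
  have key : ∀ w : E, w ≠ 0 → (∀ c ∈ C, ⟪w, c⟫_ℝ ≤ ⟪w, p₂⟫_ℝ) →
      (∀ c ∈ C, ⟪-w, c⟫_ℝ ≤ ⟪-w, a p₂⟫_ℝ) → p₁ = a p₂ ∧ p = p₂ := by
    intro w hw hmax hmin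
    have h1 : ⟪w, p₁ - p⟫_ℝ = ⟪w, a p₂ - p₂⟫_ℝ := by rw [h]
    rw [inner_sub_right, inner_sub_right] at h1
    have h2 := hmax p (memC _ hp)
    have h3 := hmin p₁ (memC _ hp₁)
    rw [inner_neg_left, inner_neg_left] at h3
    have hp' : ∀ c ∈ C, ⟪w, c⟫_ℝ ≤ ⟪w, p⟫_ℝ := fun c hc => by linarith [hmax c hc]
    have hp₁' : ∀ c ∈ C, ⟪-w, c⟫_ℝ ≤ ⟪-w, p₁⟫_ℝ := fun c hc => by
      have := hmin c hc
      rw [inner_neg_left, inner_neg_left] at this ⊢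
      linarith
    exact ⟨eq_of_forall_inner_le hCs (neg_ne_zero.mpr hw) (memC _ hp₁) (memC _ hap) hp₁' hmin,
      eq_of_forall_inner_le hCs hw (memC _ hp) (memC _ hp₂) hp' hmax⟩
  rcases N2 with N2 | N2 <;> rcases Na with Na | Na
  · exact absurd (eq_of_forall_inner_le hCs hg2 (memC _ hap) (memC _ hp₂) Na N2) hne
  · exact key (gradient e p₂) hg2 N2 Na
  · exact key (-gradient e p₂) hng2 N2 (by simpa only [neg_neg] using Na)
  · exact absurd (eq_of_forall_inner_le hCs hng2 (memC _ hap) (memC _ hp₂) Na N2) hne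

end FindCPProof

/-! ### Step 3: the table of [II] p.16 L24–58 — `LemmaFindCP` holds -/

/-- **Lemma `\Lem\findCP` of [II] holds** (`LemmaFindCP`, licence F-031 of the gate-hubbard-kl wave):
under (A2)_{2,0}, (A3) (both halves) and (A5), for `b ∈ {1,2,3}` and `p, p₁, p₂ ∈ S ∩ F` with
`Q = L_b(p₁,p₂,p) ∈ S` at which the tangent hyperplanes of `S` at `p₁` and at `p₂` are orthogonal to
`∇e(Q)`, the pair `(p₁,p₂)` is one of `(p,p)`, `(a p, p)` [`b ≠ 2`], `(p, a p)` [`b ≠ 1`],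
`(a p, a p)` [`b ≠ 3`]. Proof = the printed one (p.16 L15–58): `∇e(Q) ∥ ∇e(pᵢ)` forces
`pᵢ ∈ {Q, a(Q)}` (Gauss-map injectivity on the strictly convex `S`, with `Q` replaced by its
representative in `F`, legitimate by (A5)); then the four-row table for each `b`, whose "last row" is
excluded by Lemma `\Lem\byAfive` (i) (`eq_of_two_smul_eq_add_of_hypA3Global`) and whose other rows give
the listed configurations, lattice translates being excluded by (A5) (p.16 L77–80).
[cite: FeldmanSalmhoferTrubowitz1998, Lemma findCP §3.4 (arXiv p.16 L1–58)] -/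
theorem LemmaFindCP_holds : LemmaFindCP := by
  intro E _ _ _ cr e a hdim hA2 _ hG h5 ha b hb p hp p₁ hp₁ p₂ hp₂ hQ h1 h2
  haveI : FiniteDimensional ℝ E := Module.finite_of_finrank_pos (by omega)
  -- the representative `q ∈ S ∩ F` of `Q = L_b(p₁,p₂,p) ∈ S`
  obtain ⟨g, hgF, -⟩ := cr.existsUnique_rep (lComb b p₁ p₂ p)
  obtain ⟨q, hq_eq⟩ : ∃ q : E, q = lComb b p₁ p₂ p + (g : E) := ⟨_, rfl⟩
  have hq : q ∈ cr.fermiSurfaceRep e := by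
    refine ⟨?_, by rw [hq_eq]; exact hgF⟩
    rw [mem_fermiSurface, hq_eq, hA2.periodic _ g.2]
    exact hQ
  have hgrad_q : gradient e q = gradient e (lComb b p₁ p₂ p) := by
    have hper : (fun z => e (z + (g : E))) = e := funext fun z => hA2.periodic _ g.2 z
    rw [hq_eq]; unfold gradient; rw [← fderiv_comp_add_right (g : E), hper]
  -- Step 1: `∇e(q) ∥ ∇e(p₁)`, `∇e(q) ∥ ∇e(p₂)`
  obtain ⟨c₁, hc₁⟩ := exists_smul_of_orthogonal_imp (hA2.gradient_ne_zero p₁ hp₁.1) h1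
  obtain ⟨c₂, hc₂⟩ := exists_smul_of_orthogonal_imp (hA2.gradient_ne_zero p₂ hp₂.1) h2
  rw [← hgrad_q] at hc₁ hc₂
  -- Step 2: `q ∈ {p₁, a p₁}` and `q ∈ {p₂, a p₂}`
  have H1 : q = p₁ ∨ q = a p₁ := eq_or_eq_antipode_of_gradient_eq_smul hA2 hG h5 ha hp₁ hq hc₁
  have H2 : q = p₂ ∨ q = a p₂ := eq_or_eq_antipode_of_gradient_eq_smul hA2 hG h5 ha hp₂ hq hc₂
  have hinv : ∀ z ∈ cr.fermiSurfaceRep e, a (a z) = z := fun z hz => ha.apply_apply hA2 hG h5 hz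
  have haq : a q ∈ cr.fermiSurfaceRep e := (ha q hq).1
  have hane : a q ≠ q := ha.apply_ne hA2 hq
  -- `p₁ = a q` / `p₂ = a q` in the antipodal cases
  have H1' : q = a p₁ → p₁ = a q := fun h => by rw [h, hinv p₁ hp₁]
  have H2' : q = a p₂ → p₂ = a q := fun h => by rw [h, hinv p₂ hp₂]
  -- the "last row": `2 q = p' + a q` with `p' ∈ S ∩ F` is impossible (Lemma byAfive (i))
  have last_row : ∀ p' ∈ cr.fermiSurfaceRep e,
      (1 : ℝ) • q + (1 : ℝ) • q = (1 : ℝ) • p' + (1 : ℝ) • a q + (g : E) → False := by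
    intro p' hp' h
    have h' := h5.combo_eq_combo hq hq hp' haq (Or.inl rfl) (Or.inl rfl) (Or.inl rfl) (Or.inl rfl)
      g.2 h
    have h2q : (2 : ℝ) • q = p' + a q := by rw [two_smul]; simpa using h'
    exact hane ((eq_of_two_smul_eq_add_of_hypA3Global hG hp' hq haq h2q).2).symm
  have hγ : (g : E) ∈ cr.dualLattice := g.2
  rcases hb with rfl | rfl | rfl
  · -- `b = 1`: `Q = p + p₁ - p₂`
    have hq1 : q = p + p₁ - p₂ + (g : E) := by rw [hq_eq]; simp [lComb]
    rcases H1 with h₁ | h₁ <;> rcases H2 with h₂ | h₂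
    · -- row (θ₁, θ₁): `p = p₁ = p₂`
      have hqp : q = p := h5.eq_of_eq_add hq hp hγ (by rw [hq1, ← h₁, ← h₂]; abel)
      exact Or.inl ⟨h₁.symm.trans hqp, h₂.symm.trans hqp⟩
    · -- row (θ₂ = a θ₁, θ' = θ₁): `p = a p₁`, i.e. `(p₁, p₂) = (a p, p)`
      have hp₂' := H2' h₂
      have haqp : a q = p :=
        h5.eq_of_eq_add haq hp hγ (by linear_combination (norm := module) hq1 - h₁ - hp₂')
      refine Or.inr (Or.inl ⟨by decide, ?_, ?_⟩)
      · rw [← h₁, ← haqp, hinv q hq]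
      · rw [hp₂', haqp]
    · -- last row (θ₂ = θ₁... with θ' = a θ₁): `2 q = p + a q`, excluded
      have hp₁' := H1' h₁
      exact (last_row p hp (by linear_combination (norm := module) hq1 + hp₁' + h₂)).elim
    · -- row (a θ₁, a θ₁): `p = q`, `(p₁, p₂) = (a p, a p)`
      have hp₁' := H1' h₁
      have hp₂' := H2' h₂
      have hqp : q = p :=
        h5.eq_of_eq_add hq hp hγ (by linear_combination (norm := module) hq1 + hp₁' - hp₂')
      refine Or.inr (Or.inr (Or.inr ⟨by decide, ?_, ?_⟩))
      · rw [hp₁', hqp]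
      · rw [hp₂', hqp]
  · -- `b = 2`: `Q = p - p₁ + p₂`
    have hq2 : q = p - p₁ + p₂ + (g : E) := by rw [hq_eq]; simp [lComb]
    rcases H1 with h₁ | h₁ <;> rcases H2 with h₂ | h₂
    · have hqp : q = p := h5.eq_of_eq_add hq hp hγ (by rw [hq2, ← h₁, ← h₂]; abel)
      exact Or.inl ⟨h₁.symm.trans hqp, h₂.symm.trans hqp⟩
    · -- last row for `b = 2`
      have hp₂' := H2' h₂
      exact (last_row p hp (by linear_combination (norm := module) hq2 + h₁ + hp₂')).elim
    · -- `(p₁, p₂) = (p, a p)`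
      have hp₁' := H1' h₁
      have haqp : a q = p :=
        h5.eq_of_eq_add haq hp hγ (by linear_combination (norm := module) hq2 - hp₁' - h₂)
      refine Or.inr (Or.inr (Or.inl ⟨by decide, ?_, ?_⟩))
      · rw [hp₁', haqp]
      · rw [← h₂, ← haqp, hinv q hq]
    · have hp₁' := H1' h₁
      have hp₂' := H2' h₂
      have hqp : q = p :=
        h5.eq_of_eq_add hq hp hγ (by linear_combination (norm := module) hq2 - hp₁' + hp₂')
      refine Or.inr (Or.inr (Or.inr ⟨by decide, ?_, ?_⟩))
      · rw [hp₁', hqp]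
      · rw [hp₂', hqp]
  · -- `b = 3`: `Q = -p + p₁ + p₂`
    have hq3 : q = -p + p₁ + p₂ + (g : E) := by rw [hq_eq]; simp [lComb]
    rcases H1 with h₁ | h₁ <;> rcases H2 with h₂ | h₂
    · have hpq : p = q := h5.eq_of_eq_add hp hq hγ (by
        linear_combination (norm := module) hq3 - h₁ - h₂)
      exact Or.inl ⟨h₁.symm.trans hpq.symm, h₂.symm.trans hpq.symm⟩
    · -- `(p₁, p₂) = (a p, p)`
      have hp₂' := H2' h₂
      have hpaq : p = a q := h5.eq_of_eq_add hp haq hγ (by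
        linear_combination (norm := module) hq3 - h₁ + hp₂')
      refine Or.inr (Or.inl ⟨by decide, ?_, ?_⟩)
      · rw [← h₁, hpaq, hinv q hq]
      · rw [hp₂', hpaq]
    · -- `(p₁, p₂) = (p, a p)`
      have hp₁' := H1' h₁
      have hpaq : p = a q := h5.eq_of_eq_add hp haq hγ (by
        linear_combination (norm := module) hq3 + hp₁' - h₂)
      refine Or.inr (Or.inr (Or.inl ⟨by decide, ?_, ?_⟩))
      · rw [hp₁', hpaq]
      · rw [← h₂, hpaq, hinv q hq]
    · -- last row for `b = 3`: `p + q = 2 a q`, excluded by Lemma byAfive (i)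
      have hp₁' := H1' h₁
      have hp₂' := H2' h₂
      have h' := h5.combo_eq_combo hp hq haq haq (Or.inl rfl) (Or.inl rfl) (Or.inl rfl) (Or.inl rfl)
        (u := 1) (v := 1) (u' := 1) (v' := 1) hγ
        (by linear_combination (norm := module) hq3 + hp₁' + hp₂')
      have h2q : (2 : ℝ) • a q = p + q := by rw [two_smul]; simpa using h'.symm
      exact (hane (eq_of_two_smul_eq_add_of_hypA3Global hG hp haq hq h2q).2).elim

end Literature.MathematicalPhysics.QuantumLattice.FermiRG

end
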